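import Literature.NumberTheory.Sieve.BombieriFriedlanderIwaniecDispersionR1SecondCore
import HarnessLib

/-!
# Bombieri–Friedlander–Iwaniec 1986, §9: the bound for `ℛ₁⁺` with all parameters chosen, and Lemma 7 ⇒ `L`

Topic `Literature/NumberTheory/Sieve`.  Fifth file of the formalisation of the provable part of
§9 of E. Bombieri, J. B. Friedlander, H. Iwaniec, *Primes in arithmetic progressions to large
moduli*, Acta Math. 156 (1986), 203–251 (toward **Theorem 2**, the named fact
`Literature.NumberTheory.Sieve.BombieriFriedlanderIwaniecTheorem2`), after `…DispersionR1Second`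
and `…DispersionR1SecondCore`.  It splits the `k`-range `[1, ⌊N/R⌋]` into dyadic blocks, chooses
the auxiliary parameters of the core bound (`T(q₀) = ⌊(2q₀+1)N⌋ + 2`, `V_g = q₀N + 1`,
`V = 3Mq₀/(Q²R)`, `λ₁ = 2^j q₀²/(4Q²)`, `λ₂ = 8λ₁`), sums over the blocks, the Möbius variable `δ`
and `q₀ ≤ Q₀`, and obtains an explicit bound for `‖ℛ₁⁺‖` in terms of a bound `L` for `𝓑_m`
(`BFI.BBoundHyp`); finally it shows that BFI's Lemma 7, stated for `𝓑_m` uniformly in `m`,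
supplies such an `L` (the substitution of (9.13) into (9.15), with `ϱ = τ` on the squarefree
support).  Everything here is PROVED; no named facts are introduced.

## Contents

* `BFI.kBlock`, `BFI.mem_kBlock`, `BFI.kBlock_subset`, `BFI.sum_Icc_eq_sum_kBlock`,
  `BFI.coreSum_Icc_eq_sum_blocks`; `BFI.lamVal_mem_block` (`λ ∈ [λ₁, 8λ₁]` on a block);
  `BFI.tMod`, `BFI.tMod_pos`, `BFI.hclose_tMod`, `BFI.hlen_bound`.
* **`BFI.BBoundHyp a N Q R H β L`** — the hypothesis standing in for Lemma 7 in §9: `𝓑_m ≤ L` at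
  `(±a; 4NQ, 2Q, N/R, H, 2N)` for all `m ≥ 1` and all `|β'(h,n)| ≤ |β_n| 1_{n∼N}`.
* `BFI.r1Factor` (the explicit factor `E(q₀)`), `BFI.r1Factor_nonneg`, **`BFI.norm_coreSum_block_le`**,
  `BFI.norm_moebius_le_one`, **`BFI.norm_dispR1q0_le`**
  (`‖ℛ₁⁺(q₀)‖ ≤ τ(|a|)·2·(log₂⌊N/R⌋+1)·E(q₀)`), **`BFI.norm_dispR1C_le`**.
* `BFI.lemma7Rhs` (the right side of (9.15)), `BFI.lemma7Rhs_mono`, `BFI.bCoef`, `BFI.sum_bCoef_sq`,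
  `BFI.sum_rho_bCoef_le`, and **`BFI.bBoundHyp_of_lemma7`**: Lemma 7 for `𝓑_m` (an explicit
  hypothesis `h7`, for `±a`, uniform in `m`) gives `BBoundHyp` with
  `L = C₇ · lemma7Rhs(4NQ, 2Q, N/R, H, 2N; η; ‖β‖², D ∑_{n∼N} β_n⁴)` when `β` lives on squarefree `n`.

## Faithfulness

`E(q₀)` is, up to the logarithmic factors `T⁻¹(2V_g + T(1 + log T))`, `log₂⌊N/R⌋ + 1` and the
absolute constant `2π√8 · 3`, the quantity `q₀ M Q⁻² R⁻¹ (N/R)^{1/2} Γ(q₀) ‖β‖ ((M+2Y)B₀)^{1/2} (D_τ L)^{1/2}`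
with `Γ(q₀) = ∑_{q₀q∼Q} γ_{q₀q}² ≈ Q/q₀` and `B₀ = K₂/(π²Y)`: for `Y ≍ M` this is the prefactor
`M N^{1/2} Q^{−1} R^{−3/2} ‖β‖ · 𝓑^{1/2}` of (9.13) in the corrected form discussed in
`…DispersionR1SecondCore`.  The conversion of these factors and of `lemma7Rhs` into powers of
`x` ((9.19)–(9.20) and the range of Theorem 2) belongs to the assembly of Theorem 2.

## References

* E. Bombieri, J. B. Friedlander, H. Iwaniec, Acta Math. 156 (1986), 203–251, §9 (9.12)–(9.20)
  and Lemma 7, pp. 229–231. [BombieriFriedlanderIwaniecActa1986]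
-/

noncomputable section

open Finset Real MeasureTheory Complex
open scoped FourierTransform ArithmeticFunction.sigma

namespace Literature.NumberTheory.Sieve

namespace BFI

/-! ### Dyadic blocks in `k` -/

/-- The dyadic block `{k ∈ [1, K] : 2^j ≤ k < 2^{j+1}}`. [folklore] -/
def kBlock (Kmax j : ℕ) : Finset ℕ := (Icc 1 Kmax).filter (fun k => Nat.log 2 k = j)

/-- Members of a block: `1 ≤ k ≤ K` and `2^j ≤ k < 2^{j+1}`. [folklore] -/
theorem mem_kBlock {Kmax j k : ℕ} (hk : k ∈ kBlock Kmax j) :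
    k ∈ Icc 1 Kmax ∧ 2 ^ j ≤ k ∧ k < 2 ^ (j + 1) := by
  unfold kBlock at hk
  rw [Finset.mem_filter] at hk
  have hk1 : k ≠ 0 := by have := (Finset.mem_Icc.1 hk.1).1; omega
  refine ⟨hk.1, ?_, ?_⟩
  · rw [← hk.2]; exact Nat.pow_log_le_self 2 hk1
  · rw [← hk.2]; exact Nat.lt_pow_succ_log_self (by norm_num) k

/-- `kBlock ⊆ [1, K]`. [folklore] -/
theorem kBlock_subset (Kmax j : ℕ) : kBlock Kmax j ⊆ Icc 1 Kmax := Finset.filter_subset _ _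

/-- A sum over `1 ≤ k ≤ K` is the sum over the blocks `j ≤ log₂ K`. [folklore] -/
theorem sum_Icc_eq_sum_kBlock {M' : Type*} [AddCommMonoid M'] (Kmax : ℕ) (F : ℕ → M') :
    ∑ k ∈ Icc 1 Kmax, F k = ∑ j ∈ Finset.range (Nat.log 2 Kmax + 1), ∑ k ∈ kBlock Kmax j, F k := by
  unfold kBlock
  rw [Finset.sum_fiberwise_of_maps_to]
  intro k hk
  rw [Finset.mem_range, Nat.lt_add_one_iff]
  exact Nat.log_mono_right (Finset.mem_Icc.1 hk).2

/-- The core sum is additive in the `k`-range: over `[1, K]` it is the sum over the blocks. [folklore] -/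
theorem coreSum_Icc_eq_sum_blocks (a sg : ℤ) (M Y N Q R H : ℝ) (β γ : ℕ → ℝ) (q₀ δ Kmax : ℕ) :
    coreSum a sg M Y N Q R H β γ q₀ δ (Icc 1 Kmax) =
      ∑ j ∈ Finset.range (Nat.log 2 Kmax + 1), coreSum a sg M Y N Q R H β γ q₀ δ (kBlock Kmax j) := by
  unfold coreSum
  exact sum_Icc_eq_sum_kBlock Kmax _

/-! ### The parameters of the core bound on a block -/

/-- On the block `2^j ≤ k < 2^{j+1}` and for `q₀qᵢ ∼ Q`: `λ = k/(q₁q₂) ∈ [λ₁, 8λ₁]`,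
`λ₁ = 2^j q₀²/(4Q²)`. [folklore] -/
theorem lamVal_mem_block {Q : ℝ} (hQ : 0 < Q) {q₀ Kmax j k q₁ q₂ : ℕ} (hq₀ : 0 < q₀)
    (hk : k ∈ kBlock Kmax j) (hq₁ : q₁ ∈ qSet Q q₀) (hq₂ : q₂ ∈ qSet Q q₀) :
    (2 : ℝ) ^ j * q₀ ^ 2 / (4 * Q ^ 2) ≤ lamVal k q₁ q₂ ∧
      lamVal k q₁ q₂ ≤ 8 * ((2 : ℝ) ^ j * q₀ ^ 2 / (4 * Q ^ 2)) := by
  obtain ⟨_, hk1, hk2⟩ := mem_kBlock hk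
  have hb₁ := qSet_bounds hQ.le hq₀ hq₁
  have hb₂ := qSet_bounds hQ.le hq₀ hq₂
  have hq0 : (0 : ℝ) < q₀ := by exact_mod_cast hq₀
  have hq1pos : (0 : ℝ) < q₁ := by exact_mod_cast hb₁.1
  have hq2pos : (0 : ℝ) < q₂ := by exact_mod_cast hb₂.1
  have hk1R : (2 : ℝ) ^ j ≤ k := by exact_mod_cast hk1
  have hk2R : (k : ℝ) < 2 ^ (j + 1) := by exact_mod_cast hk2
  -- `Q/q₀ < qᵢ ≤ 2Q/q₀`
  have hl₁ : Q / q₀ < q₁ := hb₁.2.1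
  have hl₂ : Q / q₀ < q₂ := hb₂.2.1
  have hu₁ : (q₁ : ℝ) ≤ 2 * Q / q₀ := hb₁.2.2
  have hu₂ : (q₂ : ℝ) ≤ 2 * Q / q₀ := hb₂.2.2
  have hprod_hi : (q₁ : ℝ) * q₂ ≤ (2 * Q / q₀) ^ 2 := by
    rw [sq]; exact mul_le_mul hu₁ hu₂ hq2pos.le (by positivity)
  have hprod_lo : (Q / q₀) ^ 2 < (q₁ : ℝ) * q₂ := by
    rw [sq]; exact mul_lt_mul'' hl₁ hl₂ (by positivity) (by positivity)
  unfold lamVal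
  constructor
  · rw [div_le_div_iff₀ (by positivity) (by positivity)]
    calc (2 : ℝ) ^ j * q₀ ^ 2 * (q₁ * q₂) ≤ (2 : ℝ) ^ j * q₀ ^ 2 * (2 * Q / q₀) ^ 2 := by
          gcongr
      _ = 2 ^ j * (4 * Q ^ 2) := by field_simp; ring
      _ ≤ k * (4 * Q ^ 2) := by gcongr
  · rw [div_le_iff₀ (by positivity)]
    have h8 : 8 * ((2 : ℝ) ^ j * q₀ ^ 2 / (4 * Q ^ 2)) * (q₁ * q₂) =
        2 ^ (j + 1) * ((q₁ : ℝ) * q₂ / (Q / q₀) ^ 2) := by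
      field_simp; ring
    rw [h8]
    have h1 : (1 : ℝ) ≤ (q₁ : ℝ) * q₂ / (Q / q₀) ^ 2 := by
      rw [le_div_iff₀ (by positivity)]; linarith
    calc (k : ℝ) ≤ 2 ^ (j + 1) := hk2R.le
      _ = 2 ^ (j + 1) * 1 := (mul_one _).symm
      _ ≤ 2 ^ (j + 1) * ((q₁ : ℝ) * q₂ / (Q / q₀) ^ 2) := by gcongr

/-- The modulus `T(q₀) = ⌊(2q₀+1)N⌋ + 2` of the additive detection. [folklore] -/
def tMod (N : ℝ) (q₀ : ℕ) : ℕ := ⌊(2 * (q₀ : ℝ) + 1) * N⌋₊ + 2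

/-- `T(q₀) > 0`. [folklore] -/
theorem tMod_pos (N : ℝ) (q₀ : ℕ) : 0 < tMod N q₀ := by unfold tMod; omega

/-- The closeness hypothesis for `T(q₀)`: for `k ≤ N/R`, `n₁, n₂ ∼ N`, `s ≤ 2q₀kR`,
`|σ(n₂−n₁) − s| < T(q₀)`. [folklore] -/
theorem hclose_tMod {sg : ℤ} (hsg : sg = 1 ∨ sg = -1) {N R : ℝ} (hN : 0 ≤ N) (hR : 0 < R) {q₀ k : ℕ}
    (hk : k ∈ Icc 1 ⌊N / R⌋₊) {n₁ n₂ : ℕ} (hn₁ : n₁ ∈ dyadic N) (hn₂ : n₂ ∈ dyadic N) {s : ℕ}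
    (hs : s ∈ Finset.Ioc ⌊(q₀ : ℝ) * k * R⌋₊ ⌊2 * ((q₀ : ℝ) * k * R)⌋₊) :
    |sg * ((n₂ : ℤ) - n₁) - (s : ℤ)| < tMod N q₀ := by
  have h1 := (mem_dyadic hN).1 hn₁
  have h2 := (mem_dyadic hN).1 hn₂
  have hkK : (k : ℝ) ≤ N / R := by
    have := (Finset.mem_Icc.1 hk).2
    exact (Nat.cast_le.2 this).trans (Nat.floor_le (by positivity))
  have hs2 : (s : ℝ) ≤ 2 * ((q₀ : ℝ) * k * R) := by
    have := (Finset.mem_Ioc.1 hs).2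
    exact (Nat.cast_le.2 this).trans (Nat.floor_le (by positivity))
  have hkR : (k : ℝ) * R ≤ N := by rwa [le_div_iff₀ hR] at hkK
  have hsN : (s : ℝ) ≤ 2 * q₀ * N := by
    have hq0 : (0 : ℝ) ≤ q₀ := by positivity
    nlinarith
  have habs : |(sg : ℝ) * ((n₂ : ℝ) - n₁)| < N := by
    rcases hsg with rfl | rfl
    · push_cast; rw [one_mul, abs_lt]; constructor <;> linarith
    · push_cast; rw [neg_one_mul, abs_neg, abs_lt]; constructor <;> linarith
  have hT : ((2 * (q₀ : ℝ) + 1) * N) < (tMod N q₀ : ℝ) := by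
    unfold tMod; push_cast
    have := Nat.lt_floor_add_one ((2 * (q₀ : ℝ) + 1) * N)
    linarith
  have key : |(sg : ℝ) * ((n₂ : ℝ) - n₁) - s| < (tMod N q₀ : ℝ) := by
    calc |(sg : ℝ) * ((n₂ : ℝ) - n₁) - s| ≤ |(sg : ℝ) * ((n₂ : ℝ) - n₁)| + |(s : ℝ)| := abs_sub _ _
      _ < N + 2 * q₀ * N := by
          rw [abs_of_nonneg (by positivity : (0 : ℝ) ≤ s)]
          linarith
      _ = (2 * (q₀ : ℝ) + 1) * N := by ring
      _ < _ := hT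
  have : ((|sg * ((n₂ : ℤ) - n₁) - (s : ℤ)| : ℤ) : ℝ) < (tMod N q₀ : ℝ) := by
    push_cast; exact key
  exact_mod_cast this

/-- The length hypothesis: `⌊2q₀kR⌋ − ⌊q₀kR⌋ ≤ q₀N + 1` for `k ≤ N/R`. [folklore] -/
theorem hlen_bound {N R : ℝ} (hN : 0 ≤ N) (hR : 0 < R) {q₀ k : ℕ} (hk : k ∈ Icc 1 ⌊N / R⌋₊) :
    (⌊2 * ((q₀ : ℝ) * k * R)⌋₊ : ℝ) - ⌊(q₀ : ℝ) * k * R⌋₊ ≤ (q₀ : ℝ) * N + 1 := by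
  have hkK : (k : ℝ) ≤ N / R := by
    have := (Finset.mem_Icc.1 hk).2
    exact (Nat.cast_le.2 this).trans (Nat.floor_le (by positivity))
  have hkR : (k : ℝ) * R ≤ N := by rwa [le_div_iff₀ hR] at hkK
  have hx : 0 ≤ (q₀ : ℝ) * k * R := by positivity
  have h1 : (⌊2 * ((q₀ : ℝ) * k * R)⌋₊ : ℝ) ≤ 2 * ((q₀ : ℝ) * k * R) := Nat.floor_le (by positivity)
  have h2 : (q₀ : ℝ) * k * R - 1 < ⌊(q₀ : ℝ) * k * R⌋₊ := by
    have := Nat.lt_floor_add_one ((q₀ : ℝ) * k * R); linarith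
  have h3 : (q₀ : ℝ) * k * R ≤ q₀ * N := by
    have hq0 : (0 : ℝ) ≤ q₀ := by positivity
    nlinarith
  linarith


/-! ### The bound for `ℛ₁⁺(q₀)` and for `ℛ₁⁺` -/

/-- The hypothesis standing in for BFI's Lemma 7 in §9: a uniform bound `L` for `𝓑_m` at the
parameters `(4NQ, 2Q, N/R, H, 2N)` of (9.13), for both signs of `a`, every multiplier `m ≥ 1`, and
all coefficient families `|β'(h, n)| ≤ |β_n| 1_{n ∼ N}` (BFI p. 229–230: "with some
`|β(h, n₂)| = |β_{n₂}|` … Now, we appeal to Lemma 1 to infer … LEMMA 7").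
[cite: BombieriFriedlanderIwaniecActa1986, §9 (9.13)–(9.15) pp. 229–230] -/
def BBoundHyp (a : ℤ) (N Q R H : ℝ) (β : ℕ → ℝ) (L : ℝ) : Prop :=
  ∀ a' : ℤ, (a' = a ∨ a' = -a) → ∀ m : ℕ, 0 < m → ∀ β' : ℕ → ℕ → ℂ,
    (∀ h n, ‖β' h n‖ ≤ |β n|) → (∀ h n, n ∉ dyadic N → β' h n = 0) →
      dispBm a' m (4 * N * Q) (2 * Q) (N / R) H (2 * N) β' ≤ L

/-- The explicit factor `E(q₀)` of the bound for `ℛ₁⁺(q₀)`: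
`(3Mq₀/(Q²R)) · 2π(8(M+2Y)B₀)^{1/2} · T⁻¹(2(q₀N+1) + T(1+log T)) · (⌊N/R⌋ Γ(q₀)² ‖β‖²)^{1/2} (D_τ L)^{1/2}`,
`Γ(q₀) = ∑_{q₀q∼Q} γ_{q₀q}²`, `T = T(q₀)`. [folklore] -/
def r1Factor (M Y N Q R : ℝ) (β γ : ℕ → ℝ) (Dτ : ℕ) (L : ℝ) (q₀ : ℕ) : ℝ :=
  (3 * M * q₀ / (Q ^ 2 * R)) * (2 * π * Real.sqrt (8 * (M + 2 * Y) * fourierDecayConst Y)) *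
    (((tMod N q₀ : ℕ) : ℝ)⁻¹ * (2 * ((q₀ : ℝ) * N + 1) +
      (tMod N q₀ : ℕ) * (1 + Real.log (tMod N q₀ : ℕ)))) *
    (Real.sqrt (⌊N / R⌋₊ * ((∑ q ∈ qSet Q q₀, γ (q₀ * q) ^ 2) *
        (∑ q ∈ qSet Q q₀, γ (q₀ * q) ^ 2) * ∑ n ∈ dyadic N, β n ^ 2)) * Real.sqrt (Dτ * L))

/-- `E(q₀) ≥ 0`. [folklore] -/
theorem r1Factor_nonneg {M : ℝ} (Y : ℝ) {N : ℝ} (Q : ℝ) {R : ℝ} (hM : 0 ≤ M) (hN : 0 ≤ N)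
    (hR : 0 ≤ R) (β γ : ℕ → ℝ) (Dτ : ℕ) (L : ℝ) (q₀ : ℕ) : 0 ≤ r1Factor M Y N Q R β γ Dτ L q₀ := by
  unfold r1Factor
  have hT : (1 : ℝ) ≤ (tMod N q₀ : ℕ) := by exact_mod_cast tMod_pos N q₀
  have hlog : 0 ≤ Real.log (tMod N q₀ : ℕ) := Real.log_nonneg hT
  positivity

/-- **The bound for a block of the core sum with all parameters chosen** (BFI (9.13) per block):
`‖Core_σ(δ; block j)‖ ≤ E(q₀)`. [cite: BombieriFriedlanderIwaniecActa1986, §9 (9.13) p. 229] -/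
theorem norm_coreSum_block_le {a : ℤ} {sg : ℤ} (hsg : sg = 1 ∨ sg = -1) {M Y : ℝ} (hY : 0 < Y)
    (hYM : Y ≤ M) {N Q R : ℝ} (hN : 0 ≤ N) (hQ : 0 < Q) (hR : 0 < R) {H : ℝ} (hH : 0 ≤ H)
    (β γ : ℕ → ℝ) {q₀ δ : ℕ} (hq₀ : 0 < q₀) (hδ : 0 < δ) {Dτ : ℕ}
    (hDτ : ∀ c ∈ Icc 1 ⌊4 * N * Q⌋₊, c.divisors.card ≤ Dτ) {L : ℝ}
    (hL : BBoundHyp a N Q R H β L) (j : ℕ) :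
    ‖coreSum a sg M Y N Q R H β γ q₀ δ (kBlock ⌊N / R⌋₊ j)‖ ≤ r1Factor M Y N Q R β γ Dτ L q₀ := by
  have hM : 0 ≤ M := hY.le.trans hYM
  set lam₁ : ℝ := (2 : ℝ) ^ j * q₀ ^ 2 / (4 * Q ^ 2) with hl₁def
  have hl₁ : 0 < lam₁ := by positivity
  have hl₁₂ : lam₁ ≤ 8 * lam₁ := by linarith
  have hKsub := kBlock_subset ⌊N / R⌋₊ j
  have hB := norm_coreSum_le a sg hY hYM hN hQ hR hH β γ hq₀ hδ hKsub hl₁ hl₁₂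
    (fun k hk q₁ hq₁ q₂ hq₂ => lamVal_mem_block hQ hq₀ hk hq₁ hq₂) (tMod_pos N q₀)
    (fun k hk n₁ hn₁ n₂ hn₂ s hs => hclose_tMod hsg hN hR (hKsub hk) hn₁ hn₂ hs)
    (Vg := (q₀ : ℝ) * N + 1) (by positivity) (fun k hk => hlen_bound hN hR (hKsub hk)) hDτ
    (L := L) (fun t v η => hL (sg * a) (by rcases hsg with rfl | rfl <;> simp) (δ * q₀)
      (Nat.mul_pos hδ hq₀) _ (norm_betaStar_le sg N β _ t v η)
      (fun h n hn => betaStar_eq_zero sg β _ t v η h hn))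
    (V := 3 * M * q₀ / (Q ^ 2 * R)) (by positivity) le_rfl
  refine hB.trans ?_
  unfold r1Factor
  have hsq : Real.sqrt (8 * lam₁ * (M + 2 * Y) * (fourierDecayConst Y / lam₁)) =
      Real.sqrt (8 * (M + 2 * Y) * fourierDecayConst Y) := by
    congr 1; field_simp
  rw [hsq]
  have hcard : ((kBlock ⌊N / R⌋₊ j).card : ℝ) ≤ ⌊N / R⌋₊ := by
    have := Finset.card_le_card hKsub
    rw [Nat.card_Icc] at this
    exact_mod_cast (by omega : (kBlock ⌊N / R⌋₊ j).card ≤ ⌊N / R⌋₊)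
  have hT1 : (1 : ℝ) ≤ (tMod N q₀ : ℕ) := by exact_mod_cast tMod_pos N q₀
  have hlog : 0 ≤ Real.log (tMod N q₀ : ℕ) := Real.log_nonneg hT1
  gcongr

/-- `|μ(δ)| ≤ 1` in `ℂ`. [folklore] -/
theorem norm_moebius_le_one (δ : ℕ) : ‖(ArithmeticFunction.moebius δ : ℂ)‖ ≤ 1 := by
  rw [Complex.norm_intCast]
  exact_mod_cast ArithmeticFunction.abs_moebius_le_one

/-- **The bound for `ℛ₁⁺(q₀)`** (BFI §9 up to (9.13), rigorous form):
`‖ℛ₁⁺(q₀)‖ ≤ τ(|a|) · 2 · (log₂⌊N/R⌋ + 1) · E(q₀)`.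
[cite: BombieriFriedlanderIwaniecActa1986, §9 (9.1)–(9.13) pp. 227–229] -/
theorem norm_dispR1q0_le {a : ℤ} (ha : a ≠ 0) {M Y : ℝ} (hY : 0 < Y) (hYM : Y ≤ M) {N Q R : ℝ}
    (hN : 1 ≤ N) (hQ : 0 < Q) (hR : 0 < R) {H : ℝ} (hH : 0 ≤ H) (β γ : ℕ → ℝ) {q₀ : ℕ}
    (hq₀ : 0 < q₀) {Dτ : ℕ} (hDτ : ∀ c ∈ Icc 1 ⌊4 * N * Q⌋₊, c.divisors.card ≤ Dτ) {L : ℝ}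
    (hL : BBoundHyp a N Q R H β L) :
    ‖dispR1q0 a M Y N Q R H β γ q₀‖ ≤
      (a.natAbs.divisors.card : ℝ) * 2 * (Nat.log 2 ⌊N / R⌋₊ + 1) *
        r1Factor M Y N Q R β γ Dτ L q₀ := by
  have hN0 : 0 ≤ N := zero_le_one.trans hN
  have hM : 0 ≤ M := hY.le.trans hYM
  have hE := r1Factor_nonneg Y Q hM hN0 hR.le β γ Dτ L q₀
  set E := r1Factor M Y N Q R β γ Dτ L q₀ with hEdef
  rw [dispR1q0_eq_sum_moebius ha M Y H hN hQ.le hR β γ hq₀]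
  -- each core sum over `[1, K]`
  have hcore : ∀ {sg : ℤ}, (sg = 1 ∨ sg = -1) → ∀ δ ∈ a.natAbs.divisors,
      ‖coreSum a sg M Y N Q R H β γ q₀ δ (Icc 1 ⌊N / R⌋₊)‖ ≤ (Nat.log 2 ⌊N / R⌋₊ + 1) * E := by
    intro sg hsg δ hδ
    rw [coreSum_Icc_eq_sum_blocks]
    refine (norm_sum_le _ _).trans ?_
    calc ∑ j ∈ Finset.range (Nat.log 2 ⌊N / R⌋₊ + 1),
          ‖coreSum a sg M Y N Q R H β γ q₀ δ (kBlock ⌊N / R⌋₊ j)‖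
        ≤ ∑ j ∈ Finset.range (Nat.log 2 ⌊N / R⌋₊ + 1), E :=
          Finset.sum_le_sum fun j _ => norm_coreSum_block_le hsg hY hYM hN0 hQ hR hH β γ hq₀
            (Nat.pos_of_mem_divisors hδ) hDτ hL j
      _ = _ := by rw [Finset.sum_const, Finset.card_range, nsmul_eq_mul]; push_cast; ring
  refine (norm_sum_le _ _).trans ?_
  calc ∑ δ ∈ a.natAbs.divisors, ‖(ArithmeticFunction.moebius δ : ℂ) *
        (coreSum a 1 M Y N Q R H β γ q₀ δ (Icc 1 ⌊N / R⌋₊) +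
          coreSum a (-1) M Y N Q R H β γ q₀ δ (Icc 1 ⌊N / R⌋₊))‖
      ≤ ∑ δ ∈ a.natAbs.divisors, (1 * ((Nat.log 2 ⌊N / R⌋₊ + 1) * E + (Nat.log 2 ⌊N / R⌋₊ + 1) * E)) := by
        refine Finset.sum_le_sum fun δ hδ => ?_
        rw [norm_mul]
        refine mul_le_mul (norm_moebius_le_one δ) ((norm_add_le _ _).trans
          (add_le_add (hcore (Or.inl rfl) δ hδ) (hcore (Or.inr rfl) δ hδ))) (norm_nonneg _) zero_le_one
    _ = _ := by rw [Finset.sum_const, nsmul_eq_mul]; ring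

/-- **The bound for `ℛ₁⁺`** (BFI §9 up to (9.13), rigorous form, summed over `q₀ ≤ Q₀`):
`‖ℛ₁⁺‖ ≤ ∑_{q₀ ≤ Q₀} τ(|a|) · 2 · (log₂⌊N/R⌋ + 1) · E(q₀)`, where `E(q₀) = BFI.r1Factor …` carries the
factor `(D_τ L)^{1/2}` with `L` the bound for `𝓑` supplied by Lemma 7 (`BFI.BBoundHyp`).
[cite: BombieriFriedlanderIwaniecActa1986, §9 (9.1)–(9.13) pp. 227–229] -/
theorem norm_dispR1C_le {a : ℤ} (ha : a ≠ 0) {M Y : ℝ} (hY : 0 < Y) (hYM : Y ≤ M) {N Q R : ℝ}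
    (hN : 1 ≤ N) (hQ : 0 < Q) (hR : 0 < R) (Q₀ : ℝ) {H : ℝ} (hH : 0 ≤ H) (β γ : ℕ → ℝ)
    {Dτ : ℕ} (hDτ : ∀ c ∈ Icc 1 ⌊4 * N * Q⌋₊, c.divisors.card ≤ Dτ) {L : ℝ}
    (hL : BBoundHyp a N Q R H β L) :
    ‖dispR1C a M Y N Q R Q₀ H β γ‖ ≤
      ∑ q₀ ∈ Icc 1 ⌊Q₀⌋₊, (a.natAbs.divisors.card : ℝ) * 2 * (Nat.log 2 ⌊N / R⌋₊ + 1) *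
        r1Factor M Y N Q R β γ Dτ L q₀ := by
  unfold dispR1C
  refine (norm_sum_le _ _).trans (Finset.sum_le_sum fun q₀ hq₀ => ?_)
  exact norm_dispR1q0_le ha hY hYM hN hQ hR hH β γ (Finset.mem_Icc.1 hq₀).1 hDτ hL


/-! ### Lemma 7's right-hand side and the passage Lemma 7 ⇒ `BBoundHyp` -/

/-- **The right-hand side of BFI's Lemma 7** ((9.15), p. 230) at `(C, D, K, H, N)` with exponent
`η` (BFI's `ε`) and the moments `S₂ = ∑|β_n|²`, `S₄ = ∑ ϱ(n)|β_n|⁴`: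
`(CDKHN)^η {CDHK S₂ + [C(N²+HKN)(C+DN²) + C²DN√(N²+HKN) + D²HKN³]^{1/2} [H²(HK+N) S₄]^{1/2}}`.
[cite: BombieriFriedlanderIwaniecActa1986, §9 Lemma 7 (9.15) p. 230] -/
def lemma7Rhs (C D K H N η S₂ S₄ : ℝ) : ℝ :=
  (C * D * K * H * N) ^ η *
    (C * D * H * K * S₂ +
      (C * (N ^ 2 + H * K * N) * (C + D * N ^ 2) + C ^ 2 * D * N * (N ^ 2 + H * K * N) ^ (1 / 2 : ℝ) +
          D ^ 2 * H * K * N ^ 3) ^ (1 / 2 : ℝ) *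
        (H ^ 2 * (H * K + N) * S₄) ^ (1 / 2 : ℝ))

/-- `lemma7Rhs` is monotone in the moments `S₂, S₄ ≥ 0` (parameters `≥ 0`). [folklore] -/
theorem lemma7Rhs_mono {C D K H N η S₂ S₄ S₂' S₄' : ℝ} (hC : 0 ≤ C) (hD : 0 ≤ D) (hK : 0 ≤ K)
    (hH : 0 ≤ H) (hN : 0 ≤ N) (hS₄ : 0 ≤ S₄) (h₂ : S₂ ≤ S₂') (h₄ : S₄ ≤ S₄') :
    lemma7Rhs C D K H N η S₂ S₄ ≤ lemma7Rhs C D K H N η S₂' S₄' := by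
  unfold lemma7Rhs
  have h1 : 0 ≤ (C * D * K * H * N) ^ η := by positivity
  refine mul_le_mul_of_nonneg_left ?_ h1
  gcongr

/-- The coefficients `b_n = |β_n| 1_{n ∼ N}` against which `BBoundHyp` measures `β'`. [folklore] -/
def bCoef (N : ℝ) (β : ℕ → ℝ) (n : ℕ) : ℝ := if n ∈ dyadic N then |β n| else 0

/-- `∑_{n ≤ 2N} b_n² = ‖β‖²` (`N ≥ 0`). [folklore] -/
theorem sum_bCoef_sq {N : ℝ} (hN : 0 ≤ N) (β : ℕ → ℝ) :
    ∑ n ∈ Icc 1 ⌊2 * N⌋₊, bCoef N β n ^ 2 = l2Sq N β := by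
  unfold l2Sq bCoef
  rw [← Finset.sum_subset (dyadic_subset_Icc hN)]
  · refine Finset.sum_congr rfl fun n hn => ?_
    rw [if_pos hn, sq_abs]
  · intro n _ hn; rw [if_neg hn]; ring

/-- `∑_{n ≤ 2N} ϱ(n) b_n⁴ ≤ D ∑_{n∼N} β_n⁴` when `β` is supported on squarefree `n ∼ N` and
`τ(n) ≤ D` there (BFI p. 231, Remark: `ϱ(n) = τ(n)` for squarefree `n`). [cite: BombieriFriedlanderIwaniecActa1986, §9 p. 231] -/
theorem sum_rho_bCoef_le {N : ℝ} (hN : 0 ≤ N) (β : ℕ → ℝ) {D : ℝ}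
    (hsf : ∀ n ∈ dyadic N, β n ≠ 0 → Squarefree n)
    (hD : ∀ n ∈ dyadic N, (n.divisors.card : ℝ) ≤ D) :
    ∑ n ∈ Icc 1 ⌊2 * N⌋₊, (rho n : ℝ) * bCoef N β n ^ 4 ≤ D * ∑ n ∈ dyadic N, β n ^ 4 := by
  unfold bCoef
  rw [← Finset.sum_subset (dyadic_subset_Icc hN) (f := fun n => (rho n : ℝ) *
      (if n ∈ dyadic N then |β n| else 0) ^ 4)]
  · rw [Finset.mul_sum]
    refine Finset.sum_le_sum fun n hn => ?_
    rw [if_pos hn]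
    by_cases hb : β n = 0
    · rw [hb]; simp
    · have hsq := hsf n hn hb
      rw [rho_eq_card_divisors hsq]
      have : |β n| ^ 4 = β n ^ 4 := by
        rw [show (4 : ℕ) = 2 * 2 by norm_num, pow_mul, pow_mul, sq_abs]
      rw [this]
      exact mul_le_mul_of_nonneg_right (hD n hn) (by positivity)
  · intro n _ hn; rw [if_neg hn]; ring

/-- **Lemma 7 (for `𝓑_m`, uniform in `m`) implies `BBoundHyp`** with
`L = C₇ · lemma7Rhs(4NQ, 2Q, N/R, H, 2N; η; ‖β‖², D ∑_{n∼N} β_n⁴)` — the substitution of (9.13)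
into (9.15), for `β` supported on squarefree `n ∼ N` (BFI: "In the circumstances of `ℛ₁` the `n`'s
are squarefree, so `ϱ(n) = τ(n)`").  The hypothesis `h7` is BFI's Lemma 7 stated for `dispBm`.
[cite: BombieriFriedlanderIwaniecActa1986, §9 Lemma 7 and (9.19)–(9.20) pp. 230–231] -/
theorem bBoundHyp_of_lemma7 {a : ℤ} {η C₇ : ℝ}
    (h7 : ∀ a' : ℤ, (a' = a ∨ a' = -a) → ∀ m : ℕ, 0 < m → ∀ C D K H N' : ℝ,
      1 ≤ C → 1 ≤ D → 1 ≤ K → 1 ≤ H → 1 ≤ N' → ∀ (b : ℕ → ℝ) (β' : ℕ → ℕ → ℂ),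
        (∀ h n, ‖β' h n‖ ≤ |b n|) →
          dispBm a' m C D K H N' β' ≤ C₇ * lemma7Rhs C D K H N' η
            (∑ n ∈ Icc 1 ⌊N'⌋₊, b n ^ 2) (∑ n ∈ Icc 1 ⌊N'⌋₊, (rho n : ℝ) * b n ^ 4))
    (hC₇ : 0 ≤ C₇) {N Q R H : ℝ} (hN : 1 ≤ N) (hQ : 1 / 2 ≤ Q) (hR : 0 < R) (hNR : 1 ≤ N / R)
    (hH : 1 ≤ H) (β : ℕ → ℝ) (hsf : ∀ n ∈ dyadic N, β n ≠ 0 → Squarefree n) {D : ℝ}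
    (hD : ∀ n ∈ dyadic N, (n.divisors.card : ℝ) ≤ D) :
    BBoundHyp a N Q R H β (C₇ * lemma7Rhs (4 * N * Q) (2 * Q) (N / R) H (2 * N) η (l2Sq N β)
      (D * ∑ n ∈ dyadic N, β n ^ 4)) := by
  have hN0 : 0 ≤ N := zero_le_one.trans hN
  intro a' ha' m hm β' hβ' hβ'0
  have hb : ∀ h n, ‖β' h n‖ ≤ |bCoef N β n| := by
    intro h n
    unfold bCoef
    split_ifs with hn
    · rw [abs_abs]; exact hβ' h n
    · rw [hβ'0 h n hn, norm_zero, abs_zero]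
  have h := h7 a' ha' m hm (4 * N * Q) (2 * Q) (N / R) H (2 * N) (by nlinarith) (by linarith) hNR hH
    (by linarith) (bCoef N β) β' hb
  refine h.trans (mul_le_mul_of_nonneg_left ?_ hC₇)
  rw [sum_bCoef_sq hN0]
  have hS₄ : 0 ≤ ∑ n ∈ Icc 1 ⌊2 * N⌋₊, (rho n : ℝ) * bCoef N β n ^ 4 :=
    Finset.sum_nonneg fun n _ => by positivity
  exact lemma7Rhs_mono (by positivity) (by positivity) (by positivity) (by positivity)
    (by positivity) hS₄ le_rfl (sum_rho_bCoef_le hN0 β hsf hD)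


/-! ### (9.19)–(9.20): Lemma 7's right-hand side at the parameters of (9.13) -/

/-- **(9.20)** (BFI p. 231: "Then `HK < N`, so Lemma 7 yields
`𝓑 ≪ ‖β‖² x^ε Q³N²M⁻¹{Q + RN^{1/2} + RQ^{1/2}}`"), as an inequality for `lemma7Rhs` at
`(C,D,K,H,N') = (4NQ, 2Q, N/R, H, 2N)` under `HK ≤ N`, with the moments kept symbolic:
`lemma7Rhs ≤ (CDKHN')^η · (8N²Q²(H/R) S₂ + 48 (N^{5/2}Q + N²Q^{3/2}) H N^{1/2} S₄^{1/2})`.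
[cite: BombieriFriedlanderIwaniecActa1986, §9 (9.19)–(9.20) p. 231] -/
theorem lemma7Rhs_at_le {N Q R H η S₂ S₄ : ℝ} (hN : 1 ≤ N) (hQ : 1 / 2 ≤ Q) (hR : 0 < R)
    (hH : 1 ≤ H) (hHK : H * (N / R) ≤ N) (hS₄ : 0 ≤ S₄) :
    lemma7Rhs (4 * N * Q) (2 * Q) (N / R) H (2 * N) η S₂ S₄ ≤
      (4 * N * Q * (2 * Q) * (N / R) * H * (2 * N)) ^ η *
        (8 * N ^ 2 * Q ^ 2 * (H / R) * S₂ +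
          48 * (N ^ (5 / 2 : ℝ) * Q + N ^ 2 * Q ^ (3 / 2 : ℝ)) * H * N ^ (1 / 2 : ℝ) *
            S₄ ^ (1 / 2 : ℝ)) := by
  unfold lemma7Rhs
  have hN0 : 0 < N := by linarith
  have hQ0 : 0 < Q := by linarith
  have hK0 : 0 < N / R := by positivity
  have hP : 0 ≤ (4 * N * Q * (2 * Q) * (N / R) * H * (2 * N)) ^ η := by positivity
  refine mul_le_mul_of_nonneg_left ?_ hP
  have hHK' : H * (N / R) * (2 * N) ≤ 2 * N ^ 2 := by nlinarith
  -- the first term is an identity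
  have h1 : 4 * N * Q * (2 * Q) * H * (N / R) * S₂ = 8 * N ^ 2 * Q ^ 2 * (H / R) * S₂ := by
    field_simp; ring
  rw [h1]
  gcongr 8 * N ^ 2 * Q ^ 2 * (H / R) * S₂ + ?_
  -- the bracket: `A ≤ 320 (N⁵Q² + N⁴Q³)` hence `A^{1/2} ≤ √320 (N^{5/2}Q + N²Q^{3/2})`
  have hin : (2 * N) ^ 2 + H * (N / R) * (2 * N) ≤ 6 * N ^ 2 := by nlinarith
  have hin0 : 0 ≤ (2 * N) ^ 2 + H * (N / R) * (2 * N) := by positivity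
  have hsq6 : ((2 * N) ^ 2 + H * (N / R) * (2 * N)) ^ (1 / 2 : ℝ) ≤ 3 * N := by
    calc ((2 * N) ^ 2 + H * (N / R) * (2 * N)) ^ (1 / 2 : ℝ) ≤ (9 * N ^ 2) ^ (1 / 2 : ℝ) := by
          gcongr; linarith
      _ = 3 * N := by
          rw [show (9 : ℝ) * N ^ 2 = (3 * N) ^ 2 by ring, ← Real.sqrt_eq_rpow,
            Real.sqrt_sq (by linarith)]
  have hA : 4 * N * Q * ((2 * N) ^ 2 + H * (N / R) * (2 * N)) * (4 * N * Q + 2 * Q * (2 * N) ^ 2) +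
      (4 * N * Q) ^ 2 * (2 * Q) * (2 * N) * ((2 * N) ^ 2 + H * (N / R) * (2 * N)) ^ (1 / 2 : ℝ) +
        (2 * Q) ^ 2 * H * (N / R) * (2 * N) ^ 3 ≤ 512 * (N ^ 5 * Q ^ 2 + N ^ 4 * Q ^ 3) := by
    have hN1 : N ^ 4 * Q ^ 2 ≤ N ^ 5 * Q ^ 2 := by
      have : N ^ 4 ≤ N ^ 5 := pow_le_pow_right₀ hN (by norm_num)
      nlinarith [sq_nonneg Q]
    have t1 : 4 * N * Q * ((2 * N) ^ 2 + H * (N / R) * (2 * N)) * (4 * N * Q + 2 * Q * (2 * N) ^ 2) ≤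
        4 * N * Q * (6 * N ^ 2) * (4 * N * Q + 8 * Q * N ^ 2) := by
      have : 4 * N * Q + 2 * Q * (2 * N) ^ 2 = 4 * N * Q + 8 * Q * N ^ 2 := by ring
      rw [this]; gcongr
    have t2 : (4 * N * Q) ^ 2 * (2 * Q) * (2 * N) * ((2 * N) ^ 2 + H * (N / R) * (2 * N)) ^ (1 / 2 : ℝ)
        ≤ (4 * N * Q) ^ 2 * (2 * Q) * (2 * N) * (3 * N) := by gcongr
    have t3 : (2 * Q) ^ 2 * H * (N / R) * (2 * N) ^ 3 ≤ (2 * Q) ^ 2 * (2 * N ^ 2) * (2 * N) ^ 2 := by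
      have e : (2 * Q) ^ 2 * H * (N / R) * (2 * N) ^ 3 = (2 * Q) ^ 2 * (H * (N / R) * (2 * N)) * (2 * N) ^ 2 := by
        ring
      rw [e]; gcongr
    calc _ ≤ 4 * N * Q * (6 * N ^ 2) * (4 * N * Q + 8 * Q * N ^ 2) +
          (4 * N * Q) ^ 2 * (2 * Q) * (2 * N) * (3 * N) + (2 * Q) ^ 2 * (2 * N ^ 2) * (2 * N) ^ 2 :=
          add_le_add (add_le_add t1 t2) t3
      _ = 96 * N ^ 4 * Q ^ 2 + 192 * N ^ 5 * Q ^ 2 + 192 * N ^ 4 * Q ^ 3 + 32 * N ^ 4 * Q ^ 2 := by ring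
      _ ≤ 512 * (N ^ 5 * Q ^ 2 + N ^ 4 * Q ^ 3) := by
          have h5 : 0 ≤ N ^ 5 * Q ^ 2 := by positivity
          have h6 : 0 ≤ N ^ 4 * Q ^ 3 := by positivity
          linarith
  have hA0 : 0 ≤ 4 * N * Q * ((2 * N) ^ 2 + H * (N / R) * (2 * N)) * (4 * N * Q + 2 * Q * (2 * N) ^ 2) +
      (4 * N * Q) ^ 2 * (2 * Q) * (2 * N) * ((2 * N) ^ 2 + H * (N / R) * (2 * N)) ^ (1 / 2 : ℝ) +
        (2 * Q) ^ 2 * H * (N / R) * (2 * N) ^ 3 := by positivity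
  -- `√(512 (N⁵Q² + N⁴Q³)) ≤ √512 (N^{5/2} Q + N² Q^{3/2})`
  have hsqA : (4 * N * Q * ((2 * N) ^ 2 + H * (N / R) * (2 * N)) * (4 * N * Q + 2 * Q * (2 * N) ^ 2) +
      (4 * N * Q) ^ 2 * (2 * Q) * (2 * N) * ((2 * N) ^ 2 + H * (N / R) * (2 * N)) ^ (1 / 2 : ℝ) +
        (2 * Q) ^ 2 * H * (N / R) * (2 * N) ^ 3) ^ (1 / 2 : ℝ) ≤
      24 * (N ^ (5 / 2 : ℝ) * Q + N ^ 2 * Q ^ (3 / 2 : ℝ)) := by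
    have hx' : (N ^ (5 / 2 : ℝ)) ^ 2 = N ^ 5 := by
      rw [← Real.rpow_natCast _ 2, ← Real.rpow_mul hN0.le]; norm_num
    have hy' : (Q ^ (3 / 2 : ℝ)) ^ 2 = Q ^ 3 := by
      rw [← Real.rpow_natCast _ 2, ← Real.rpow_mul hQ0.le]; norm_num
    have hx : N ^ 5 * Q ^ 2 = (N ^ (5 / 2 : ℝ) * Q) ^ 2 := by rw [mul_pow, hx']
    have hy : N ^ 4 * Q ^ 3 = (N ^ 2 * Q ^ (3 / 2 : ℝ)) ^ 2 := by rw [mul_pow, hy']; ring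
    have hsum : 512 * (N ^ 5 * Q ^ 2 + N ^ 4 * Q ^ 3) ≤ (24 * (N ^ (5 / 2 : ℝ) * Q + N ^ 2 * Q ^ (3 / 2 : ℝ))) ^ 2 := by
      rw [hx, hy]
      have ha : 0 ≤ N ^ (5 / 2 : ℝ) * Q := by positivity
      have hb : 0 ≤ N ^ 2 * Q ^ (3 / 2 : ℝ) := by positivity
      nlinarith [mul_nonneg ha hb]
    calc _ ≤ (512 * (N ^ 5 * Q ^ 2 + N ^ 4 * Q ^ 3)) ^ (1 / 2 : ℝ) := by gcongr
      _ ≤ ((24 * (N ^ (5 / 2 : ℝ) * Q + N ^ 2 * Q ^ (3 / 2 : ℝ))) ^ 2) ^ (1 / 2 : ℝ) := by gcongr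
      _ = 24 * (N ^ (5 / 2 : ℝ) * Q + N ^ 2 * Q ^ (3 / 2 : ℝ)) := by
          rw [← Real.sqrt_eq_rpow, Real.sqrt_sq (by positivity)]
  -- the fourth-moment factor: `(H²(HK+N')S₄)^{1/2} ≤ H (3N)^{1/2} S₄^{1/2} ≤ (4/3)·... ` we use `√3 ≤ 4/3·...`:
  have hHK2 : H * (N / R) + 2 * N ≤ 3 * N := by linarith
  have h4 : (H ^ 2 * (H * (N / R) + 2 * N) * S₄) ^ (1 / 2 : ℝ) ≤ H * ((3 * N) ^ (1 / 2 : ℝ) * S₄ ^ (1 / 2 : ℝ)) := by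
    calc (H ^ 2 * (H * (N / R) + 2 * N) * S₄) ^ (1 / 2 : ℝ) ≤ (H ^ 2 * (3 * N) * S₄) ^ (1 / 2 : ℝ) := by
          gcongr
      _ = (H ^ 2) ^ (1 / 2 : ℝ) * ((3 * N) ^ (1 / 2 : ℝ) * S₄ ^ (1 / 2 : ℝ)) := by
          rw [Real.mul_rpow (by positivity) hS₄, Real.mul_rpow (by positivity) (by positivity), mul_assoc]
      _ = H * ((3 * N) ^ (1 / 2 : ℝ) * S₄ ^ (1 / 2 : ℝ)) := by
          rw [← Real.sqrt_eq_rpow (H ^ 2), Real.sqrt_sq (by linarith)]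
  have h3 : (3 * N) ^ (1 / 2 : ℝ) ≤ 2 * N ^ (1 / 2 : ℝ) := by
    rw [Real.mul_rpow (by norm_num) hN0.le]
    have : (3 : ℝ) ^ (1 / 2 : ℝ) ≤ 2 := by
      rw [← Real.sqrt_eq_rpow, Real.sqrt_le_left (by norm_num)]; norm_num
    exact mul_le_mul_of_nonneg_right this (by positivity)
  calc _ ≤ 24 * (N ^ (5 / 2 : ℝ) * Q + N ^ 2 * Q ^ (3 / 2 : ℝ)) * (H * ((3 * N) ^ (1 / 2 : ℝ) * S₄ ^ (1 / 2 : ℝ))) :=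
        mul_le_mul hsqA h4 (by positivity) (by positivity)
    _ ≤ 24 * (N ^ (5 / 2 : ℝ) * Q + N ^ 2 * Q ^ (3 / 2 : ℝ)) * (H * (2 * N ^ (1 / 2 : ℝ) * S₄ ^ (1 / 2 : ℝ))) := by
        gcongr
    _ = 48 * (N ^ (5 / 2 : ℝ) * Q + N ^ 2 * Q ^ (3 / 2 : ℝ)) * H * N ^ (1 / 2 : ℝ) * S₄ ^ (1 / 2 : ℝ) := by ring

end BFI

end Literature.NumberTheory.Sieve
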